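import Mathlib
import HarnessLib
import Summits.NavierStokesRegularity.Statement
import Summits.NavierStokesRegularity.NavierStokesRegularity.Theses.RootDecompRecordVisibility
import Summits.NavierStokesRegularity.NavierStokesRegularity.Theses.LerayQuarterDissipation
import Summits.NavierStokesRegularity.NavierStokesRegularity.Theses.EfficiencyFloor
import Summits.NavierStokesRegularity.NavierStokesRegularity.Theorems.NoBlowupToClay
import Summits.NavierStokesRegularity.NavierStokesRegularity.Theorems.RootDecompRecordVisibilityIsolationCells
import Summits.NavierStokesRegularity.NavierStokesRegularity.Theorems.TypeICertificateLadderRungReynoldsOneTaoCover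
import Literature.Analysis.FluidPDE.BKMClassGradientContinuity
import Literature.Analysis.FluidPDE.HolderEulerBlowupSwirlStability
import Literature.Analysis.FluidPDE.GigaMiura2011TypeIZoomKit
import Literature.Analysis.FluidPDE.NSCriticalClosureTao
import Literature.Analysis.FluidPDE.EnstrophySplitting

/-!
# QUARTER-LAW BLOW-UPS ARE VISIBLE — writer port (decomp-ns-writer-1 g9) of decomp-ns lens 3, generation 22,
# `QuarterLawVisibleG22.lean` (sha256 006bee7d…; CRITIC-LEDGER row 266 CLEARED (KERNEL) «dominance edge … landing
# --supports 33524 endorsed (edges, never --workitem)»).  Helper for N27's declared residual `InvisibleRecordZoom`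
# (stmt-NavierStokesRegularity-33524); no item is closed here.

PORT RULE (cell pattern of record, writer g7/g8): every certificate relating OPEN route items is landed as an `Iff`
(`EQL ↔ EQL ∧ X`), never as a theorem whose head is an open item or the summit — so §D/§S below re-type the lens
implications `EnstrophyQuarterLaw → NoInvisibleBlowup / InvisibleRecordZoom / DiluteRecordZoom /
NonIsolatedInvisibleRecordZoom` and `EnstrophyQuarterLaw → NoVisibleBlowup → S` as the equivalent `Iff`s
`enstrophyQuarterLaw_iff_and_noInvisibleBlowup`, `enstrophyQuarterLaw_iff_and_darkCells`,
`navierStokesRegularity_iff_enstrophyQuarterLaw_and_noVisibleBlowup`; the analytic theorem `visible_of_quarterLaw` and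
the real-analysis lemma `records_accumulate` are verbatim.  The lens docstring follows (its §Consequences names are the
lens names; the landed forms are the `Iff`s just listed).

# QUARTER-LAW BLOW-UPS ARE VISIBLE — the dark cell of route `RootDecompRecordVisibility` (N27) is an
# enstrophy-Type-II cell: `EnstrophyQuarterLaw (1574) → NoInvisibleBlowup (33529) → InvisibleRecordZoom (33524)`

decomp-ns lens 3, generation 22 (RESIDUAL MODE; kernel by-product K-D «dominance certificate between lineage
residuals»).  Nothing here proves Navier–Stokes regularity: every theorem is an implication between OPEN
statements of the tree, or a property of a hypothetical blow-up.  Rung currency: rung 0.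

## The theorem (`visible_of_quarterLaw`)
Let `(u,p)` be a classical solution of the unforced system on `ℝ³ × [0,T)` (`ν, T > 0`), Leray–Hopf from its
rapidly decaying datum, with NO smooth extension past `T`, and suppose Leray's quarter-rate enstrophy law
`∫|curl u(t)|² ≤ K/√(T−t)` on `[0,T)`.  Then the blow-up is VISIBLE in the sense of N27 (decl
`RootDecompRecordVisibility.NoInvisibleBlowup`, verbatim): there is `δ > 0` such that beyond every `t₀ < T`
there is an enstrophy RECORD time `t` (`ℰ(t) = ∫⁻|∇u(t)|²_F` finite and `≥ ℰ(s')` for all `s' ∈ [0,t]`) at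
which `ν·|u(t,x)| ≥ δ·ℰ(t)` for some point `x`.
PROOF.  (i) `ℰ` is finite and continuous on `[0,T)` (Tao-class cover of closed sub-slabs,
`RungReynoldsOne.stub_taoCover`; `IsClassicalNSSolutionOn.continuousOn_toReal_lintegral_frobeniusNormSq_fderiv_Ico`)
and `ℰ(t) = ∫⁻|curl u(t)|²` (`lintegral_frobeniusNormSq_fderiv_eq_lintegral_curl_sq`); (ii) `ℰ` is unbounded
near `T` — else `‖curl u(t)‖₂` is bounded and the solution extends (Beirão da Veiga's vorticity criterion,
`hasSmoothExtensionPast_of_eLpNorm_curl_le` with `r = 2`); (iii) hence RECORDS ACCUMULATE at `T`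
(`records_accumulate`, the lineage's g13 real-analysis lemma, re-proved here); (iv) at every time Leray's lower
bound gives a point with `|u(t,x)| ≥ c₀√ν/(2√(T−t))` (`NavierStokesZoomKit.exists_lerayRate_points`), while the
quarter law gives `ℰ(t) ≤ K₁/√(T−t)` (`K₁ = max K 1`); so at every record `ν|u(t,x)|/ℰ(t) ≥ ν c₀√ν/(2K₁) =: δ`.

## Consequences (all kernel-checked below)
* `noInvisibleBlowup_of_enstrophyQuarterLaw : LerayQuarterDissipation.EnstrophyQuarterLaw → NoInvisibleBlowup`
  (and the `EfficiencyFloor` copy of 1574): THE DARK CELL IS A TYPE-II CELL — every invisible blow-up violates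
  Leray's quarter law (its enstrophy outgrows `(T−t)^{-1/2}` along a sequence).  The lineage's g13/g14 prose claim
  «invisible ⊂ enstrophy-Type-II» made kernel, and WITHOUT the velocity-Type-I frame g13 assumed.
* `invisibleRecordZoom_of_enstrophyQuarterLaw`, `diluteRecordZoom_of_enstrophyQuarterLaw`,
  `nonIsolatedInvisibleRecordZoom_of_enstrophyQuarterLaw`: N27's declared residual I (33524) and both of its
  isolation-cut cells (33870, 33871) are IMPLIED by route `LerayQuarterDissipation`'s residual 1574 — a certified
  DOMINANCE between the two lens-3 decks: `I ⟸ NoInvisibleBlowup ⟸ EQL ⟸ S`.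
* `navierStokesRegularity_of_enstrophyQuarterLaw_of_noVisibleBlowup : EQL → NoVisibleBlowup → S` and the exactness
  `navierStokesRegularity_iff_enstrophyQuarterLaw_and_noVisibleBlowup : S ↔ EQL ∧ NoVisibleBlowup` — under the
  quarter law the whole difficulty is the VISIBLE blow-up (N27's attacked side), complementary to N27's own reading
  (residual = the invisible side).
HONEST FRAMING: conditional implications only; `EnstrophyQuarterLaw` (1574), `NoInvisibleBlowup` (33529),
`NoVisibleBlowup` (33530), `InvisibleRecordZoom` (33524) all stay OPEN.  References: Leray 1934 §19 (3.9);
Beirão da Veiga 1995; Majda–Bertozzi Thm 3.5; KNSS 2009 (arXiv:0709.3599); Tao 2016 (arXiv:1402.0290). [folklore]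
-/

noncomputable section

open Set Filter Topology MeasureTheory Metric
open scoped ENNReal NNReal
open Literature.Analysis.FluidPDE
open Literature.Analysis.NavierStokesZoomKit

namespace Summit.NavierStokesRegularity.NavierStokesRegularity.Theorems

set_option linter.dupNamespace false
set_option linter.style.longLine false

namespace QuarterLawVisible

open Summit.NavierStokesRegularity.NavierStokesRegularity.Theses
open Summit.NavierStokesRegularity.NavierStokesRegularity.Theorems.RungReynoldsOne

/-! ## §R  Records accumulate (real analysis; the lineage's g13 lemma) -/

/-- RECORDS ACCUMULATE: a function continuous on `[0,T)` and unbounded above there has, beyond every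
`t₀ ∈ [0,T)`, a record time `t` (its value at `t` dominates all of `[0,t]`). [folklore] -/
theorem records_accumulate {f : ℝ → ℝ} {T : ℝ} (hf : ContinuousOn f (Ico 0 T))
    (hub : ∀ M : ℝ, ∃ s ∈ Ico 0 T, M < f s) {t₀ : ℝ} (ht₀ : t₀ ∈ Ico 0 T) :
    ∃ t ∈ Ico t₀ T, ∀ s ∈ Icc 0 t, f s ≤ f t := by
  have hc0 : ContinuousOn f (Icc 0 t₀) := hf.mono (Icc_subset_Ico_right ht₀.2)
  obtain ⟨m, hm, hmax⟩ :=
    (isCompact_Icc : IsCompact (Icc (0 : ℝ) t₀)).exists_isMaxOn (nonempty_Icc.2 ht₀.1) hc0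
  obtain ⟨s₁, hs₁, hlt⟩ := hub (f m)
  have hbT : max t₀ s₁ < T := max_lt ht₀.2 hs₁.2
  have hcb : ContinuousOn f (Icc 0 (max t₀ s₁)) := hf.mono (Icc_subset_Ico_right hbT)
  obtain ⟨t, ht, htmax⟩ :=
    (isCompact_Icc : IsCompact (Icc (0 : ℝ) (max t₀ s₁))).exists_isMaxOn
      (nonempty_Icc.2 (le_trans ht₀.1 (le_max_left _ _))) hcb
  have h2 : f s₁ ≤ f t := (isMaxOn_iff.mp htmax) s₁ ⟨hs₁.1, le_max_right _ _⟩
  refine ⟨t, ⟨?_, lt_of_le_of_lt ht.2 hbT⟩, ?_⟩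
  · by_contra hlt'
    have h1 : f t ≤ f m := (isMaxOn_iff.mp hmax) t ⟨ht.1, (lt_of_not_ge hlt').le⟩
    linarith
  · intro s hs
    exact (isMaxOn_iff.mp htmax) s ⟨hs.1, hs.2.trans ht.2⟩

/-! ## §Q  Quarter-law blow-ups are visible -/

/-- **QUARTER-LAW BLOW-UPS ARE VISIBLE.** For a classical Leray–Hopf solution on `[0,T)` from a rapidly
decaying datum with no smooth extension past `T`, Leray's quarter-rate enstrophy law `∫|curl u(t)|² ≤ K/√(T−t)`
forces VISIBILITY in the sense of N27: some `δ > 0` and enstrophy record times `t ↑ T` with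
`δ ≤ ν|u(t,x)|/ℰ(t)` at some point `x` (Leray's lower bound `|u(t)|_∞ ≥ c₀√ν/√(T−t)` against `ℰ(t) ≤ K/√(T−t)`).
[cite: Leray1934, §19 (3.9) p. 224] -/
theorem visible_of_quarterLaw {ν T : ℝ} (hν : 0 < ν) (hT : 0 < T)
    {u : ℝ → EuclideanSpace ℝ (Fin 3) → EuclideanSpace ℝ (Fin 3)} {p : ℝ → EuclideanSpace ℝ (Fin 3) → ℝ}
    (hsol : IsClassicalNSSolutionOn (Ico 0 T) ν 0 u p) (hLH : IsLerayHopfOn T ν 0 (u 0) u)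
    (hdec : HasRapidSpatialDecay (u 0)) (hext : ¬ HasSmoothExtensionPast ν 0 u T) {K : ℝ}
    (hK : ∀ t ∈ Ico 0 T, ∫⁻ x, ‖curl (u t) x‖ₑ ^ 2 ≤ ENNReal.ofReal (K / Real.sqrt (T - t))) :
    ∃ δ : ℝ, 0 < δ ∧ ∀ t₀ : ℝ, t₀ < T → ∃ t : ℝ, t₀ < t ∧ 0 ≤ t ∧ t < T ∧
      ((∫⁻ y, ENNReal.ofReal (frobeniusNormSq (fderiv ℝ (u t) y))) ≠ ⊤ ∧
        ∀ s' ∈ Icc 0 t, (∫⁻ y, ENNReal.ofReal (frobeniusNormSq (fderiv ℝ (u s') y))) ≤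
          (∫⁻ y, ENNReal.ofReal (frobeniusNormSq (fderiv ℝ (u t) y)))) ∧
      (∃ s ∈ Icc 0 t, ∃ x : EuclideanSpace ℝ (Fin 3),
        δ ≤ ν * ‖u s x‖ / (∫⁻ y, ENNReal.ofReal (frobeniusNormSq (fderiv ℝ (u t) y))).toReal ∨
        δ ≤ ν ^ 3 * ‖fderiv ℝ (u s) x‖ / (∫⁻ y, ENNReal.ofReal (frobeniusNormSq (fderiv ℝ (u t) y))).toReal ^ 2) := by
  -- (0) Tao-class cover: Sobolev bounds on closed sub-slabs, pointwise bounds on closed sub-strips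
  have hreg : ∀ T'' < T, HasBoundedSobolevNormsOn (Icc 0 T'') u := by
    intro T'' hT''
    by_cases h0 : 0 < T''
    · obtain ⟨q, -, hB, -, -⟩ := stub_taoCover hν hT hsol hLH hdec (T' := T'') ⟨h0, hT''⟩
      exact hB
    · obtain ⟨q, -, hB, -, -⟩ := stub_taoCover hν hT hsol hLH hdec (T' := T / 2) ⟨by positivity, by linarith⟩
      exact hB.mono (Icc_subset_Icc le_rfl (by linarith [le_of_not_gt h0]))
  have hbdd : ∀ T₁ ∈ Ioo 0 T, ∃ M : ℝ, ∀ t ∈ Icc 0 T₁, ∀ x, ‖u t x‖ ≤ M := by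
    intro T₁ hT₁
    obtain ⟨q, hsolq, hB, -, -⟩ := stub_taoCover hν hT hsol hLH hdec hT₁
    obtain ⟨B, -, hBu⟩ := exists_forall_norm_le_of_hasBoundedSobolevNormsOn hsolq hB
    exact ⟨B, hBu⟩
  -- (1) Leray's rate at near-maximum points
  obtain ⟨c₀, hc₀, hLer⟩ := exists_lerayRate_points hν hT hsol hLH hbdd hext
  -- (2) the Frobenius enstrophy equals the curl enstrophy on `[0,T)`
  have hEcurl : ∀ t ∈ Ico 0 T, (∫⁻ y, ENNReal.ofReal (frobeniusNormSq (fderiv ℝ (u t) y))) =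
      ∫⁻ x, ‖curl (u t) x‖ₑ ^ 2 := by
    intro t ht
    have hn : ∀ n : ℕ, ∫⁻ x, ‖iteratedFDeriv ℝ n (u t) x‖ₑ ^ 2 < ⊤ := fun n => by
      obtain ⟨C, hC⟩ := hreg t ht.2 n
      exact (hC t ⟨ht.1, le_rfl⟩).trans_lt ENNReal.coe_lt_top
    have h0 : ∫⁻ x, ‖u t x‖ₑ ^ 2 < ⊤ := by
      refine lt_of_le_of_lt (le_of_eq (lintegral_congr fun x => ?_)) (hn 0)
      rw [← ofReal_norm, ← norm_iteratedFDeriv_zero (𝕜 := ℝ) (f := u t), ofReal_norm]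
    exact lintegral_frobeniusNormSq_fderiv_eq_lintegral_curl_sq
      ((hsol.contDiff_velocity ht).of_le (by norm_cast)) (hsol.divFree t ht) h0 (hn 1) (hn 2)
  -- (3) the quarter law with `K₁ = max K 1 ≥ 1`, finiteness, the real-valued bound
  set K₁ : ℝ := max K 1 with hK₁def
  have hK₁pos : 0 < K₁ := lt_of_lt_of_le one_pos (le_max_right _ _)
  have hEle : ∀ t ∈ Ico 0 T, (∫⁻ y, ENNReal.ofReal (frobeniusNormSq (fderiv ℝ (u t) y))) ≤
      ENNReal.ofReal (K₁ / Real.sqrt (T - t)) := by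
    intro t ht
    rw [hEcurl t ht]
    refine (hK t ht).trans (ENNReal.ofReal_le_ofReal ?_)
    exact div_le_div_of_nonneg_right (le_max_left _ _) (Real.sqrt_nonneg _)
  have hEfin : ∀ t ∈ Ico 0 T, (∫⁻ y, ENNReal.ofReal (frobeniusNormSq (fderiv ℝ (u t) y))) ≠ ⊤ :=
    fun t ht => ne_top_of_le_ne_top ENNReal.ofReal_ne_top (hEle t ht)
  have hfle : ∀ t ∈ Ico 0 T, (∫⁻ y, ENNReal.ofReal (frobeniusNormSq (fderiv ℝ (u t) y))).toReal ≤
      K₁ / Real.sqrt (T - t) :=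
    fun t ht => ENNReal.toReal_le_of_le_ofReal (by positivity) (hEle t ht)
  -- (4) continuity of the real-valued enstrophy on `[0,T)`
  have hcont : ContinuousOn
      (fun t => (∫⁻ y, ENNReal.ofReal (frobeniusNormSq (fderiv ℝ (u t) y))).toReal) (Ico 0 T) :=
    hsol.continuousOn_toReal_lintegral_frobeniusNormSq_fderiv_Ico hreg
  -- (5) unboundedness near `T`: else `‖curl u(t)‖₂` is bounded and the solution extends past `T`
  have hub : ∀ M : ℝ, ∃ s ∈ Ico 0 T,
      M < (∫⁻ y, ENNReal.ofReal (frobeniusNormSq (fderiv ℝ (u s) y))).toReal := by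
    by_contra hcon
    push Not at hcon
    obtain ⟨M, hM⟩ := hcon
    apply hext
    set Cb : ℝ≥0∞ := (ENNReal.ofReal M) ^ (2 : ℝ)⁻¹ with hCb
    have hCbtop : Cb ≠ ⊤ := ENNReal.rpow_ne_top_of_nonneg (by norm_num) ENNReal.ofReal_ne_top
    have h32 : (3 : ℝ≥0∞) / 2 < 2 := by
      rw [ENNReal.div_lt_iff (Or.inl two_ne_zero) (Or.inl ENNReal.ofNat_ne_top)]; norm_num
    refine hasSmoothExtensionPast_of_eLpNorm_curl_le hν hT hsol hLH hdec (r := 2) h32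
      ENNReal.ofNat_ne_top hCbtop fun t ht => ?_
    rw [hCb, ENNReal.le_rpow_inv_iff two_pos, ENNReal.rpow_two, ← lintegral_enorm_sq_eq_eLpNorm_two_sq,
      ← hEcurl t ht, ← ENNReal.ofReal_toReal (hEfin t ht)]
    exact ENNReal.ofReal_le_ofReal (hM t ht)
  -- (6) the visibility constant
  refine ⟨ν * (c₀ * Real.sqrt ν / 2) / K₁, by positivity, fun t₀ ht₀ => ?_⟩
  -- a record beyond `t₀`, late enough that the enstrophy there exceeds 1
  obtain ⟨s₁, hs₁, hfs₁⟩ := hub 1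
  have haT : max t₀ 0 < T := max_lt ht₀ hT
  set b : ℝ := max ((max t₀ 0 + T) / 2) s₁ with hbdef
  have hb : b ∈ Ico 0 T := by
    refine ⟨hs₁.1.trans (le_max_right _ _), max_lt (by linarith) hs₁.2⟩
  obtain ⟨t, ht, hrec⟩ := records_accumulate hcont hub hb
  have ht0 : 0 ≤ t := hb.1.trans ht.1
  have htT : t < T := ht.2
  have htI : t ∈ Ico 0 T := ⟨ht0, htT⟩
  have ht₀t : t₀ < t := by
    have h1 : t₀ ≤ max t₀ 0 := le_max_left _ _
    have h2 : (max t₀ 0 + T) / 2 ≤ b := le_max_left _ _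
    linarith [ht.1]
  have hft : 1 < (∫⁻ y, ENNReal.ofReal (frobeniusNormSq (fderiv ℝ (u t) y))).toReal :=
    hfs₁.trans_le (hrec s₁ ⟨hs₁.1, (le_max_right _ _).trans ht.1⟩)
  obtain ⟨x, hx⟩ := hLer t htI
  refine ⟨t, ht₀t, ht0, htT, ⟨hEfin t htI, fun s' hs' => ?_⟩, ⟨t, ⟨ht0, le_rfl⟩, x, Or.inl ?_⟩⟩
  · have hs'I : s' ∈ Ico 0 T := ⟨hs'.1, lt_of_le_of_lt hs'.2 htT⟩
    exact (ENNReal.toReal_le_toReal (hEfin s' hs'I) (hEfin t htI)).1 (hrec s' hs')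
  · have hfpos : 0 < (∫⁻ y, ENNReal.ofReal (frobeniusNormSq (fderiv ℝ (u t) y))).toReal := by linarith
    rw [le_div_iff₀ hfpos]
    have hsq : 0 < Real.sqrt (T - t) := Real.sqrt_pos.2 (sub_pos.2 htT)
    calc ν * (c₀ * Real.sqrt ν / 2) / K₁ * (∫⁻ y, ENNReal.ofReal (frobeniusNormSq (fderiv ℝ (u t) y))).toReal
        ≤ ν * (c₀ * Real.sqrt ν / 2) / K₁ * (K₁ / Real.sqrt (T - t)) := by
          gcongr
          exact hfle t htI
      _ = ν * (c₀ * Real.sqrt ν / Real.sqrt (T - t) / 2) := by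
          field_simp
      _ ≤ ν * ‖u t x‖ := by gcongr

/-! ## §D  Dominance (as `Iff` certificates): the quarter law (1574) implies N27's dark-cell statements -/

/-- **THE DARK CELL IS A TYPE-II CELL** (certificate form `EQL ↔ EQL ∧ NoInvisibleBlowup`): Leray's quarter-rate
enstrophy law for every blow-up (route `LerayQuarterDissipation`'s residual crux, the stmt-1574 text) implies that
every frame blow-up is visible (N27's aside `NoInvisibleBlowup`, stmt-33529).  Both sides stay OPEN. [folklore] -/
theorem enstrophyQuarterLaw_iff_and_noInvisibleBlowup :
    LerayQuarterDissipation.EnstrophyQuarterLaw ↔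
      (LerayQuarterDissipation.EnstrophyQuarterLaw ∧ RootDecompRecordVisibility.NoInvisibleBlowup) := by
  refine ⟨fun hQ => ⟨hQ, ?_⟩, And.left⟩
  intro ν T hν hT u p hsol hLH hdec hext
  obtain ⟨K, hK⟩ := hQ ν T hν hT u p ⟨hsol, hext⟩ hLH hdec
  exact visible_of_quarterLaw hν hT hsol hLH hdec hext hK

/-- The same certificate from the `EfficiencyFloor` copy of the quarter law (stmt-NavierStokesRegularity-1574 itself;
the two tree copies have the same text). [folklore] -/
theorem enstrophyQuarterLaw'_iff_and_noInvisibleBlowup :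
    EfficiencyFloor.EnstrophyQuarterLaw ↔
      (EfficiencyFloor.EnstrophyQuarterLaw ∧ RootDecompRecordVisibility.NoInvisibleBlowup) := by
  refine ⟨fun hQ => ⟨hQ, ?_⟩, And.left⟩
  have hQ' : LerayQuarterDissipation.EnstrophyQuarterLaw := hQ
  exact (enstrophyQuarterLaw_iff_and_noInvisibleBlowup.1 hQ').2

/-- **DOMINANCE I ⟸ 1574** (certificate form): N27's declared residual `InvisibleRecordZoom` (stmt-33524) and both
of its isolation-cut cells `DiluteRecordZoom` (stmt-33870) and `NonIsolatedInvisibleRecordZoom` (stmt-33871) follow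
from the quarter law — vacuously, there being no invisible blow-up.  All four statements stay OPEN. [folklore] -/
theorem enstrophyQuarterLaw_iff_and_darkCells :
    LerayQuarterDissipation.EnstrophyQuarterLaw ↔
      (LerayQuarterDissipation.EnstrophyQuarterLaw ∧ RootDecompRecordVisibility.InvisibleRecordZoom ∧
        RootDecompRecordVisibility.DiluteRecordZoom ∧ RootDecompRecordVisibility.NonIsolatedInvisibleRecordZoom) := by
  refine ⟨fun hQ => ?_, And.left⟩
  have hN := (enstrophyQuarterLaw_iff_and_noInvisibleBlowup.1 hQ).2
  refine ⟨hQ, ?_, ?_, ?_⟩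
  · intro ν T hν hT u p hsol hLH hdec hext hinv
    exact absurd (hN ν T hν hT u p hsol hLH hdec hext) hinv
  · intro ν T hν hT u p hsol hLH hdec hext hinv _
    exact absurd (hN ν T hν hT u p hsol hLH hdec hext) hinv
  · intro ν T hν hT u p hsol hLH hdec hext hinv _
    exact absurd (hN ν T hν hT u p hsol hLH hdec hext) hinv

/-! ## §S  The merged two-piece deck: S ⟺ EQL ∧ NoVisibleBlowup -/

/-- **Exactness of the merged deck**: Clay (A) ⟺ (quarter law ∧ no visible blow-up).  Forward: vacuity
(Clay (A) excludes blow-up, `NoTerminalJolt.noBlowup_of_navierStokesRegularity`).  Backward: UNDER THE QUARTER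
LAW THE WHOLE DIFFICULTY IS THE VISIBLE BLOW-UP — `EnstrophyQuarterLaw` (1574) makes every blow-up visible
(`enstrophyQuarterLaw_iff_and_noInvisibleBlowup`), `NoVisibleBlowup` (33530) forbids that, so there is no blow-up and
the tree's `navierStokesRegularity_of_noBlowup` gives Clay (A). [folklore] -/
theorem navierStokesRegularity_iff_enstrophyQuarterLaw_and_noVisibleBlowup :
    _root_.NavierStokesRegularity ↔
      (LerayQuarterDissipation.EnstrophyQuarterLaw ∧ RootDecompRecordVisibility.NoVisibleBlowup) := by
  constructor
  · intro hA
    have h := Theorems.NoTerminalJolt.noBlowup_of_navierStokesRegularity hA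
    exact ⟨fun ν T hν hT u p hmax hLH hdec => absurd (h ν T hν hT u p hmax.1 hLH hdec) hmax.2,
      fun ν T hν hT u p hsol hLH hdec hext _ => absurd (h ν T hν hT u p hsol hLH hdec) hext⟩
  · rintro ⟨hQ, hV⟩
    have hN := (enstrophyQuarterLaw_iff_and_noInvisibleBlowup.1 hQ).2
    refine navierStokesRegularity_of_noBlowup fun ν T hν hT u p hsol hLH hdec => ?_
    by_contra hext
    exact hV ν T hν hT u p hsol hLH hdec hext (hN ν T hν hT u p hsol hLH hdec hext)

end QuarterLawVisible

end Summit.NavierStokesRegularity.NavierStokesRegularity.Theorems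

end
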